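import Summits.HodgeConjecture.HodgeConjecture.Theorems.CyclicUnitaryPowersEigenGeometricGenusOfResidues
import Literature.AlgebraicGeometry.HodgeTheory.GriffithsResiduesPoleOrderOneExact
import Literature.AlgebraicGeometry.HodgeTheory.HodgeFiltrationModelsReductionProofs
import Literature.AlgebraicGeometry.HodgeTheory.CyclicCoverDeckInvariantsTransfer
import Literature.AlgebraicGeometry.HodgeTheory.CyclicEigenspaceDimensions
import Literature.AlgebraicGeometry.HodgeTheory.FermatCurveJacobianCMType

/-!
# Route `CyclicUnitaryPowers`, crux K1-A (stmt-HodgeConjecture-19544): the `(2,0)`- and `(0,2)`-eigen-Hodge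
# numbers of the deck transformation FROM THE GEOMETRIC GENUS ALONE

For a non-zero ternary form `f` of degree `p ≥ 4` with smooth projective `p`-cyclic cover
`X_F = V₊(x₃^p − f) ⊂ ℙ³`, deck transformation `σ_F : x₃ ↦ ζ_p x₃`, the binder
`stub_ct99EigenHodgeNumbers : carlsonToledo1999_finrank_eigenspace_inf_hodgePiece` asserts
`dim (H²(X_F)_{ζ^i} ∩ H^{2−q,q}) = dim R_f^{(q+1)p−3−i}`. Granted ONLY the numerical upper bound
`h^{2,0}(X_F) ≤ dim S₄^{p−4}` (`= C(p−1,3)`, the geometric genus of a smooth surface of degree `p` in `ℙ³`;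
adjunction `K = 𝒪(p−4)` with Serre's GAGA — the surjectivity half of Voisin II Cor. 6.12 at pole order one,
not in the tree), this file PROVES the clauses `q = 0` and `q = 2`:

* `idealDegree_jacobianIdeal_eq_bot_of_lt` — the Jacobian ideal of a form of degree `p` has no non-zero
  elements of degree `< p − 1`;
* `finrank_eigenspace_inf_hodgePiece_two_zero_eq` — `q = 0` in the binder's spelling:
  `dim (H²(X_F)_{ζ^i} ∩ H^{2,0}) = dim S₃^{p−3−i} − dim J_f^{p−3−i}` (`0` for `p < 3 + i`);
* `starRingEnd_rootOfUnity_pow` — `conj(ζ_p^i) = ζ_p^{p−i}`;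
* `finrank_eigenspace_inf_hodgePiece_zero_two_eq` — `q = 2` in RESIDUE form:
  `dim (H²(X_F)_{ζ^i} ∩ H^{0,2}) = dim S₃^{i−3} − dim J_f^{i−3}` (`0` for `i < 3`), by Hodge symmetry
  (`conj` swaps `H^{2,0}_{ζ^{p−i}}` and `H^{0,2}_{ζ^i}`); the binder's spelling `dim R_f^{3p−3−i}` is the
  same number by the symmetry `dim R_f^a = dim R_f^{3p−6−a}` of the complete intersection `R_f` (Macaulay),
  recorded separately.

Inputs (all PROVED): Griffiths' residues at pole order one (`GriffithsResiduesPoleOrderOne{,Exact}`), the count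
`CyclicUnitaryPowersJacobianEigenpartsCount`, Hodge symmetry of eigenspaces (Shioda 1981 Lemma 2.1). References:
Carlson–Toledo, Duke Math. J. 97 (1999) §5; Voisin, Hodge Theory II (2003) §6.1.3 Cor. 6.12; Shioda, Ann. Sci. ÉNS
14 (1981) §2 Lemma 2.1; Hartshorne (1977) II Ex. 8.20.3.
-/

noncomputable section

open CategoryTheory AlgebraicGeometry MvPolynomial

-- mandated namespace `Summit.HodgeConjecture.HodgeConjecture.Theorems` trips `linter.dupNamespace` (off tree-wide)
set_option linter.dupNamespace false

namespace Summit.HodgeConjecture.HodgeConjecture.Theorems.CyclicUnitaryPowersEigenHodgeOfGeometricGenus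

open Literature.AlgebraicGeometry.Motives Literature.AlgebraicGeometry.HodgeTheory
open Literature.RingTheory.MvPolynomial (idealDegree mem_idealDegree)
open Summit.HodgeConjecture.HodgeConjecture.Theorems.CyclicUnitaryPowersCyclicCoverIrreducible
  (isHomogeneous_cyclicCoverForm)
open Summit.HodgeConjecture.HodgeConjecture.Theorems.CyclicUnitaryPowersJacobianEigenpartsCount
  (finrank_eigenpart_sub_finrank_eigenpart_jacobianIdeal)
open Summit.HodgeConjecture.HodgeConjecture.Theorems.CyclicUnitaryPowersEigenGeometricGenusOfResidues
  (le_finrank_eigenspace_inf_hodgePiece_two_zero)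

/-! ### §1 The Jacobian ideal is generated in degree `p − 1` -/
section Jacobian

variable {N : ℕ}

/-- **A homogeneous ideal generated in degree `p − 1` has no coefficients of lower degree**: for `F`
homogeneous of degree `p`, every element of the Jacobian ideal `J_F = (∂₀F, …, ∂_N F)` has vanishing
coefficient at every exponent of degree `< p − 1` (the partials are homogeneous of degree `p − 1`, and
`coeff_e (a · P) = Σ_{e₁+e₂=e} coeff_{e₁} a · coeff_{e₂} P`). [cite: VoisinHodgeII2003, §6.1.3 Def. 6.9] -/
theorem coeff_eq_zero_of_mem_jacobianIdeal {F : MvPolynomial (Fin (N + 1)) ℂ} {p : ℕ} (hF : F.IsHomogeneous p)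
    {P : MvPolynomial (Fin (N + 1)) ℂ} (hP : P ∈ UniversalHypersurface.jacobianIdeal F)
    {e : Fin (N + 1) →₀ ℕ} (he : e.degree + 1 < p) : coeff e P = 0 := by
  induction hP using Submodule.span_induction generalizing e with
  | mem x hx =>
    obtain ⟨j, rfl⟩ := hx
    exact (hF.pderiv (i := j)).coeff_eq_zero (by omega)
  | zero => exact coeff_zero e
  | add x y _ _ hx hy => rw [coeff_add, hx he, hy he, add_zero]
  | smul a x _ hx =>
    rw [smul_eq_mul, coeff_mul]
    refine Finset.sum_eq_zero fun q hq ↦ ?_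
    have hq' := Finset.HasAntidiagonal.mem_antidiagonal.mp hq
    have hdeg : q.2.degree ≤ e.degree := by
      rw [← hq', map_add]
      exact Nat.le_add_left _ _
    rw [hx (by omega), mul_zero]

/-- **`J_F` has no non-zero elements of degree `k < p − 1`**: `idealDegree (jacobianIdeal F) k = ⊥` for
`F` homogeneous of degree `p` and `k + 1 < p`. [cite: VoisinHodgeII2003, §6.1.3 Def. 6.9] -/
theorem idealDegree_jacobianIdeal_eq_bot_of_lt {F : MvPolynomial (Fin (N + 1)) ℂ} {p : ℕ}
    (hF : F.IsHomogeneous p) {k : ℕ} (hk : k + 1 < p) :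
    idealDegree (UniversalHypersurface.jacobianIdeal F) k = ⊥ := by
  refine eq_bot_iff.mpr fun P hP ↦ ?_
  obtain ⟨hPJ, hPk⟩ := mem_idealDegree.mp hP
  rw [Submodule.mem_bot]
  ext e
  rw [coeff_zero]
  by_cases hdeg : e.degree = k
  · exact coeff_eq_zero_of_mem_jacobianIdeal hF hPJ (by omega)
  · exact hPk.coeff_eq_zero hdeg

end Jacobian

/-! ### §2 The `(2,0)`-eigen-Hodge numbers from the geometric genus -/
section Cyclic

variable {p : ℕ} {f : MvPolynomial (Fin 3) ℂ}

/-- **Carlson–Toledo §5 at `q = 0`, granted the geometric genus**: for a non-zero ternary form `f` of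
degree `p ≥ 4` with `X_F = V₊(x₃^p − f)` smooth projective, deck transformation `σ_F`, `ζ_p = e^{2πi/p}`,
`1 ≤ i ≤ p − 1`, and GRANTED `h^{2,0}(X_F) ≤ dim S₄^{p−4}` (`hpg`; the surjectivity of the residue map
`S₄^{p−4} → H^{2,0}(X_F)`, Voisin II Cor. 6.12 at pole order one / adjunction `K_{X_F} = 𝒪(p−4)`):
`dim_ℂ (H²(X_F)_{ζ^i} ∩ H^{2,0}) = dim S₃^{p−3−i} − dim J_f^{p−3−i}` (`= dim R_f^{p−3−i}`; `0` when
`p < 3 + i`), the `q = 0` clause of `carlsonToledo1999_finrank_eigenspace_inf_hodgePiece` verbatim. Proof: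
the residues exhaust `H^{2,0}` equivariantly (`finrank_eigenspace_inf_piece_eq_of_finrank_piece_le`), the
`ζ^i`-part of `S₄^{p−4}` is counted by `finrank_eigenpart_sub_finrank_eigenpart_jacobianIdeal`, and
`J_F^{p−4} = 0` (`idealDegree_jacobianIdeal_eq_bot_of_lt`). [cite: CarlsonToledo1999, §5 (held text p0011–p0012)]
[cite: VoisinHodgeII2003, §6.1.3 Cor. 6.12 (p = 1)] -/
theorem finrank_eigenspace_inf_hodgePiece_two_zero_eq (hHD : exists_isReal_hodgeModel) (hp : 4 ≤ p)
    (hf : f.IsHomogeneous p) (hf0 : f ≠ 0)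
    (hX : IsSmoothProjective 2 (SmoothHypersurface.hypersurface (cyclicCoverForm p f)))
    (ha : deckUnit p ∈ diagonalStabilizer (cyclicCoverForm p f))
    (hpg : Module.finrank ℂ ↥((BettiUniverse.hodge hHD hX 2).piece 2 0) ≤
      Module.finrank ℂ ↥(homogeneousSubmodule (Fin 4) ℂ (p - 4)))
    {i : ℕ} (hi : 1 ≤ i) (hip : i < p) :
    Module.finrank ℂ ↥(Module.End.eigenspace
          ((BettiUniverse.pull (diagonalAut (cyclicCoverForm p f) ha) 2).baseChange ℂ)
          (Complex.exp (2 * (Real.pi : ℂ) * Complex.I / (p : ℂ)) ^ i) ⊓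
        (BettiUniverse.hodge hHD hX 2).piece 2 0) =
      if p < 3 + i then 0 else
        Module.finrank ℂ ↥(homogeneousSubmodule (Fin 3) ℂ (p - 3 - i)) -
          Module.finrank ℂ ↥(idealDegree (UniversalHypersurface.jacobianIdeal f) (p - 3 - i)) := by
  obtain ⟨k, rfl⟩ : ∃ k, p = k + 4 := ⟨p - 4, by omega⟩
  set ζ := Complex.exp (2 * (Real.pi : ℂ) * Complex.I / ((k + 4 : ℕ) : ℂ)) with hζ
  have hF : (cyclicCoverForm (k + 4) f).IsHomogeneous (k + 4) := isHomogeneous_cyclicCoverForm hf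
  have hJ := CyclicCoverFormNonsingular.isNonsingularForm_cyclicCoverForm_of_isSmoothProjective
    (by omega) hf hf0 hX
  -- the residues exhaust `H^{2,0}`, equivariantly
  have hpg' : Module.finrank ℂ ↥((BettiUniverse.hodge hHD hX 2).piece ((2 : ℕ) : ℤ) 0) ≤
      Module.finrank ℂ ↥(homogeneousSubmodule (Fin (2 + 2)) ℂ (k + 4 - (2 + 2))) := by
    have h4 : k + 4 - (2 + 2) = k + 4 - 4 := by omega
    rw [h4]
    exact_mod_cast hpg
  have key := finrank_eigenspace_inf_piece_eq_of_finrank_piece_le hHD (n := 2) (by norm_num) (by omega)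
    hF hJ hX hpg' ha (ζ ^ i)
  have h4 : k + 4 - (2 + 2) = k := by omega
  rw [h4] at key
  -- the Jacobian count, with `J_F^{p-4} = 0`
  have count := finrank_eigenpart_sub_finrank_eigenpart_jacobianIdeal (by omega : 2 ≤ k + 4) f hi hip k
  have hJ0 : idealDegree (UniversalHypersurface.jacobianIdeal (cyclicCoverForm (k + 4) f)) k = ⊥ :=
    idealDegree_jacobianIdeal_eq_bot_of_lt hF (by omega)
  rw [hJ0, inf_bot_eq, finrank_bot, Nat.sub_zero] at count
  have he : k + 4 - 3 - i = k + 1 - i := by omega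
  rw [he]
  by_cases hlt : k + 1 < i
  · rw [if_pos (by omega)]
    rw [if_pos hlt] at count
    rw [← count]
    exact_mod_cast key
  · rw [if_neg (by omega)]
    rw [if_neg hlt] at count
    rw [← count]
    exact_mod_cast key

/-! ### §3 The `(0,2)`-eigen-Hodge numbers, by Hodge symmetry -/

/-- `conj (ζ_p^i) = ζ_p^{p−i}` for `ζ_p = e^{2πi/p}` and `i ≤ p`. [folklore] -/
theorem starRingEnd_exp_pow {p i : ℕ} (hp : p ≠ 0) (hip : i ≤ p) :
    starRingEnd ℂ (Complex.exp (2 * (Real.pi : ℂ) * Complex.I / (p : ℂ)) ^ i) =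
      Complex.exp (2 * (Real.pi : ℂ) * Complex.I / (p : ℂ)) ^ (p - i) := by
  set ζ := Complex.exp (2 * (Real.pi : ℂ) * Complex.I / (p : ℂ)) with hζ
  have hζp : ζ ^ p = 1 := (Complex.isPrimitiveRoot_exp p hp).pow_eq_one
  have hζ0 : ζ ≠ 0 := Complex.exp_ne_zero _
  have hconj : starRingEnd ℂ ζ = ζ⁻¹ := by
    rw [hζ, ← Complex.exp_conj, ← Complex.exp_neg]
    congr 1
    simp only [map_div₀, map_mul, map_ofNat, Complex.conj_ofReal, Complex.conj_I, map_natCast]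
    ring
  rw [map_pow, hconj, inv_pow, pow_sub₀ _ hζ0 hip, hζp, one_mul]

/-- **Carlson–Toledo §5 at `q = 2`, granted the geometric genus, in residue form**: with the hypotheses
of `finrank_eigenspace_inf_hodgePiece_two_zero_eq`,
`dim_ℂ (H²(X_F)_{ζ^i} ∩ H^{0,2}) = dim S₃^{i−3} − dim J_f^{i−3}` (`= dim R_f^{i−3}`; `0` when `i < 3`):
complex conjugation carries `H^{0,2}_{ζ^i}` onto `H^{2,0}_{ζ^{p−i}}` (`finrank_eigenspace_inf_piece_zero_top_eq`,
`conj ζ^i = ζ^{p−i}`), whose dimension is the `q = 0` count at `p − i`. In the binder's spelling this number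
is `dim R_f^{3p−3−i}` (Gorenstein symmetry `dim R_f^a = dim R_f^{3p−6−a}` of the complete intersection
`R_f`). [cite: CarlsonToledo1999, §5 (held text p0011–p0012)] [cite: Shioda1981PicardNumber, §2 Lemma 2.1 (proof)] -/
theorem finrank_eigenspace_inf_hodgePiece_zero_two_eq (hHD : exists_isReal_hodgeModel) (hp : 4 ≤ p)
    (hf : f.IsHomogeneous p) (hf0 : f ≠ 0)
    (hX : IsSmoothProjective 2 (SmoothHypersurface.hypersurface (cyclicCoverForm p f)))
    (ha : deckUnit p ∈ diagonalStabilizer (cyclicCoverForm p f))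
    (hpg : Module.finrank ℂ ↥((BettiUniverse.hodge hHD hX 2).piece 2 0) ≤
      Module.finrank ℂ ↥(homogeneousSubmodule (Fin 4) ℂ (p - 4)))
    {i : ℕ} (hi : 1 ≤ i) (hip : i < p) :
    Module.finrank ℂ ↥(Module.End.eigenspace
          ((BettiUniverse.pull (diagonalAut (cyclicCoverForm p f) ha) 2).baseChange ℂ)
          (Complex.exp (2 * (Real.pi : ℂ) * Complex.I / (p : ℂ)) ^ i) ⊓
        (BettiUniverse.hodge hHD hX 2).piece 0 2) =
      if i < 3 then 0 else
        Module.finrank ℂ ↥(homogeneousSubmodule (Fin 3) ℂ (i - 3)) -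
          Module.finrank ℂ ↥(idealDegree (UniversalHypersurface.jacobianIdeal f) (i - 3)) := by
  have hsymm := finrank_eigenspace_inf_piece_zero_top_eq hHD hodgePQ_independent_of_hodgeModel_holds hX
    (diagonalAut (cyclicCoverForm p f) ha) 2 (Complex.exp (2 * (Real.pi : ℂ) * Complex.I / (p : ℂ)) ^ i)
  rw [starRingEnd_exp_pow (by omega) hip.le] at hsymm
  have h20 := finrank_eigenspace_inf_hodgePiece_two_zero_eq hHD hp hf hf0 hX ha hpg
    (i := p - i) (by omega) (by omega)
  have hsymm' : Module.finrank ℂ ↥(Module.End.eigenspace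
          ((BettiUniverse.pull (diagonalAut (cyclicCoverForm p f) ha) 2).baseChange ℂ)
          (Complex.exp (2 * (Real.pi : ℂ) * Complex.I / (p : ℂ)) ^ i) ⊓
        (BettiUniverse.hodge hHD hX 2).piece 0 2) =
      Module.finrank ℂ ↥(Module.End.eigenspace
          ((BettiUniverse.pull (diagonalAut (cyclicCoverForm p f) ha) 2).baseChange ℂ)
          (Complex.exp (2 * (Real.pi : ℂ) * Complex.I / (p : ℂ)) ^ (p - i)) ⊓
        (BettiUniverse.hodge hHD hX 2).piece 2 0) := by
    exact_mod_cast hsymm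
  rw [hsymm', h20]
  have he : p - 3 - (p - i) = i - 3 := by omega
  rw [he]
  by_cases hi3 : i < 3
  · rw [if_pos (by omega), if_pos hi3]
  · rw [if_neg (by omega), if_neg hi3]

end Cyclic

/-! ### §4 The `(1,1)`-eigen-Hodge numbers from the geometric genus and the second Betti number -/

section Betti

variable {p : ℕ} {f : MvPolynomial (Fin 3) ℂ}

/-- `g_a` depends on the vector `a` only (proof irrelevance in the membership). [folklore] -/
theorem diagonalAut_congr' {F : MvPolynomial (Fin 4) ℂ} {a b : Fin 4 → ℂˣ}
    (ha : a ∈ diagonalStabilizer F) (hb : b ∈ diagonalStabilizer F) (h : a = b) :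
    diagonalAut F ha = diagonalAut F hb := by
  subst h
  rfl

/-- `(σ_F^*)^p = 1` on `H²(X_F(ℂ); ℚ)` for the deck transformation `σ_F = g_a`, `a = deckUnit p`
(`pull` is contravariantly multiplicative, `a ↦ g_a` is a homomorphism, `a^p = 1`). [cite: HatcherAT2002, §3.1 p. 198] -/
theorem pull_deck_pow_eq_one (hp : p ≠ 0) (ha : deckUnit p ∈ diagonalStabilizer (cyclicCoverForm p f)) (k : ℕ) :
    BettiUniverse.pull (diagonalAut (cyclicCoverForm p f) ha) k ^ p = 1 := by
  set F := cyclicCoverForm p f with hFdef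
  have hpow : ∀ m : ℕ, BettiUniverse.pull (diagonalAut F ha) k ^ m =
      BettiUniverse.pull (diagonalAut F (pow_mem ha m)) k := by
    intro m
    induction m with
    | zero =>
      rw [pow_zero, diagonalAut_congr' (pow_mem ha 0) (one_mem _) (pow_zero _), diagonalAut_one,
        BettiUniverse.pull_id]
      rfl
    | succ m ih =>
      rw [pow_succ, ih, diagonalAut_congr' (pow_mem ha (m + 1)) (mul_mem (pow_mem ha m) ha) (pow_succ _ m),
        diagonalAut_mul, BettiUniverse.pull_comp]
      rfl
  rw [hpow, diagonalAut_congr' (pow_mem ha p) (one_mem _) (deckUnit_pow_self hp), diagonalAut_one,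
    BettiUniverse.pull_id]
  rfl

/-- **The eigenspaces `H²(X_F)_{ζ^i}`, `1 ≤ i ≤ p − 1`, all have dimension `p² − 3p + 3`** for `p` PRIME,
granted `b₂(X_F) = p³ − 4p² + 6p − 2`: by Galois equidistribution (`p` prime, the `ζ^i` are the primitive
`p`-th roots; Shioda 1981 §1 / Carlson–Toledo §2 "`H(μ)` Galois conjugate") `b₂ = dim H²(X_F)^{σ} + (p−1)·m`,
the invariant line has dimension `1` (`carlsonToledo1999_finrank_eigenspace_deck_one_holds`, PROVED), and
`p³ − 4p² + 6p − 3 = (p−1)(p² − 3p + 3)`. [cite: CarlsonToledo1999, §2 (held text p0005)]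
[cite: Shioda1981PicardNumber, §1 (1.1)–(1.4)] -/
theorem finrank_eigenspace_deck_eq (hp : p.Prime) (hp3 : 3 ≤ p) (hf : f.IsHomogeneous p) (hf0 : f ≠ 0)
    (hX : IsSmoothProjective 2 (SmoothHypersurface.hypersurface (cyclicCoverForm p f)))
    (ha : deckUnit p ∈ diagonalStabilizer (cyclicCoverForm p f))
    (hb2 : Module.finrank ℚ ↥(bettiCohomology (SmoothHypersurface.hypersurface (cyclicCoverForm p f)) 2) =
      p ^ 3 + 6 * p - (4 * p ^ 2 + 2))
    {i : ℕ} (hi : 1 ≤ i) (hip : i < p) :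
    Module.finrank ℂ ↥(Module.End.eigenspace
        ((BettiUniverse.pull (diagonalAut (cyclicCoverForm p f) ha) 2).baseChange ℂ)
        (Complex.exp (2 * (Real.pi : ℂ) * Complex.I / (p : ℂ)) ^ i)) = p ^ 2 - 3 * p + 3 := by
  classical
  set X := SmoothHypersurface.hypersurface (cyclicCoverForm p f) with hXdef
  set τ := BettiUniverse.pull (diagonalAut (cyclicCoverForm p f) ha) 2 with hτ
  set ζ := Complex.exp (2 * (Real.pi : ℂ) * Complex.I / (p : ℂ)) with hζ
  haveI : Module.Finite ℚ ↥(bettiCohomology X 2) := BettiUniverse.finite hX 2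
  have hp0 : 0 < p := hp.pos
  have hτp : τ ^ p = 1 := pull_deck_pow_eq_one hp.ne_zero ha 2
  have hprim : IsPrimitiveRoot ζ p := Complex.isPrimitiveRoot_exp p hp.ne_zero
  have hζi : ζ ^ i ∈ primitiveRoots p ℂ := by
    rw [mem_primitiveRoots hp0]
    exact hprim.pow_of_coprime i (Nat.coprime_of_lt_prime (by omega) hip hp).symm
  have h1 : (1 : ℂ) ∈ primitiveRoots 1 ℂ := by simp [IsPrimitiveRoot.primitiveRoots_one]
  -- Galois equidistribution: `b₂ = r₁ + (p - 1) r_p`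
  have hsum := HodgeStructure.FiniteOrder.finrank_eq_sum_totient_mul_cyclMult hp0 hτp
  rw [Nat.Prime.divisors hp, Finset.sum_pair hp.one_lt.ne, Nat.totient_one, Nat.totient_prime hp, one_mul,
    ← HodgeStructure.FiniteOrder.finrank_eigenspace_eq_cyclMult hp0 hτp h1,
    ← HodgeStructure.FiniteOrder.finrank_eigenspace_eq_cyclMult hp0 hτp hζi,
    finrank_eigenspace_baseChange_one_eq hp0 hτp,
    carlsonToledo1999_finrank_eigenspace_deck_one_holds hp3 f hf hf0 hX ha, hb2] at hsum
  -- arithmetic: `p³ + 6p − (4p² + 2) = 1 + (p − 1)(p² − 3p + 3)`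
  obtain ⟨k, rfl⟩ : ∃ k, p = k + 3 := ⟨p - 3, by omega⟩
  set m := Module.finrank ℂ ↥(Module.End.eigenspace (τ.baseChange ℂ) (ζ ^ i)) with hm
  have e1 : (k + 3) ^ 2 - 3 * (k + 3) + 3 = k ^ 2 + 3 * k + 3 := by
    zify [(by nlinarith : 3 * (k + 3) ≤ (k + 3) ^ 2)]
    ring
  have e2 : (k + 3) ^ 3 + 6 * (k + 3) - (4 * (k + 3) ^ 2 + 2) = 1 + (k + 3 - 1) * (k ^ 2 + 3 * k + 3) := by
    zify [(by nlinarith : 4 * (k + 3) ^ 2 + 2 ≤ (k + 3) ^ 3 + 6 * (k + 3)), (by omega : 1 ≤ k + 3)]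
    ring
  rw [e1]
  rw [e2] at hsum
  have h3 : (k + 3 - 1) * m = (k + 3 - 1) * (k ^ 2 + 3 * k + 3) := by omega
  exact Nat.eq_of_mul_eq_mul_left (by omega) h3

/-- **Carlson–Toledo §5 at `q = 1`, granted the geometric genus and `b₂`, in residue form**: with `p`
prime, `p ≥ 5`, and the hypotheses of `finrank_eigenspace_inf_hodgePiece_two_zero_eq` plus
`b₂(X_F) = p³ − 4p² + 6p − 2`,
`dim_ℂ (H²(X_F)_{ζ^i} ∩ H^{1,1}) = (p² − 3p + 3) − dim R_f^{p−3−i} − dim R_f^{i−3}` (the two residue counts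
read as `0` outside their ranges): the eigenspace `H²(X_F)_{ζ^i}` (dimension `p² − 3p + 3`,
`finrank_eigenspace_deck_eq`) splits along the `σ_F`-stable Hodge decomposition `H^{2,0} ⊕ H^{1,1} ⊕ H^{0,2}`.
In the binder's spelling this number is `dim R_f^{2p−3−i}` (an identity of the Hilbert function of the
complete intersection `R_f`, recorded separately). [cite: CarlsonToledo1999, §5 (held text p0011–p0012)]
[cite: Shioda1981PicardNumber, §1 (1.4) and §2 Lemma 2.1] -/
theorem finrank_eigenspace_inf_hodgePiece_one_one_eq (hHD : exists_isReal_hodgeModel) (hp : p.Prime)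
    (hp5 : 5 ≤ p) (hf : f.IsHomogeneous p) (hf0 : f ≠ 0)
    (hX : IsSmoothProjective 2 (SmoothHypersurface.hypersurface (cyclicCoverForm p f)))
    (ha : deckUnit p ∈ diagonalStabilizer (cyclicCoverForm p f))
    (hpg : Module.finrank ℂ ↥((BettiUniverse.hodge hHD hX 2).piece 2 0) ≤
      Module.finrank ℂ ↥(homogeneousSubmodule (Fin 4) ℂ (p - 4)))
    (hb2 : Module.finrank ℚ ↥(bettiCohomology (SmoothHypersurface.hypersurface (cyclicCoverForm p f)) 2) =
      p ^ 3 + 6 * p - (4 * p ^ 2 + 2))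
    {i : ℕ} (hi : 1 ≤ i) (hip : i < p) :
    Module.finrank ℂ ↥(Module.End.eigenspace
          ((BettiUniverse.pull (diagonalAut (cyclicCoverForm p f) ha) 2).baseChange ℂ)
          (Complex.exp (2 * (Real.pi : ℂ) * Complex.I / (p : ℂ)) ^ i) ⊓
        (BettiUniverse.hodge hHD hX 2).piece 1 1) =
      (p ^ 2 - 3 * p + 3) -
        (if p < 3 + i then 0 else
          Module.finrank ℂ ↥(homogeneousSubmodule (Fin 3) ℂ (p - 3 - i)) -
            Module.finrank ℂ ↥(idealDegree (UniversalHypersurface.jacobianIdeal f) (p - 3 - i))) -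
        (if i < 3 then 0 else
          Module.finrank ℂ ↥(homogeneousSubmodule (Fin 3) ℂ (i - 3)) -
            Module.finrank ℂ ↥(idealDegree (UniversalHypersurface.jacobianIdeal f) (i - 3))) := by
  classical
  rw [← finrank_eigenspace_inf_hodgePiece_two_zero_eq hHD (by omega) hf hf0 hX ha hpg hi hip,
    ← finrank_eigenspace_inf_hodgePiece_zero_two_eq hHD (by omega) hf hf0 hX ha hpg hi hip,
    ← finrank_eigenspace_deck_eq hp (by omega) hf hf0 hX ha hb2 hi hip]
  set X := SmoothHypersurface.hypersurface (cyclicCoverForm p f) with hXdef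
  set H := BettiUniverse.hodge hHD hX 2 with hHdef
  set gC := (BettiUniverse.pull (diagonalAut (cyclicCoverForm p f) ha) 2).baseChange ℂ with hgC
  set μ := Complex.exp (2 * (Real.pi : ℂ) * Complex.I / (p : ℂ)) ^ i with hμ
  haveI : Module.Finite ℚ ↥(bettiCohomology X 2) := BettiUniverse.finite hX 2
  -- the Hodge decomposition `⊤ = F¹ ⊕ V^{0,2}`, `F¹ = F² ⊕ V^{1,1}`, `F² = V^{2,0}`, stable under `gC`
  set gH := BettiUniverse.pullHodgeHom hHD hodgePQ_independent_of_hodgeModel_holds hX hX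
    (diagonalAut (cyclicCoverForm p f) ha) 2 with hgH
  have hgH' : gH.toLinearMap.baseChange ℂ = gC := by
    rw [hgH, BettiUniverse.pullHodgeHom_toLinearMap]
  have hstabF : ∀ (r : ℤ), ∀ x ∈ H.F r, gC x ∈ H.F r := fun r x hx ↦ by
    rw [← hgH']; exact gH.baseChange_mem_F _ hx
  have hstabP : ∀ (a b : ℤ), ∀ x ∈ H.piece a b, gC x ∈ H.piece a b := fun a b x hx ↦ by
    rw [← hgH']; exact gH.baseChange_mem_piece hx
  have hF0 : H.F 0 = H.F 1 ⊔ H.piece 0 2 := by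
    have h := HodgeStructure.F_eq_F_succ_sup_piece H 0
    norm_num at h
    exact h
  have hF1 : H.F 1 = H.F 2 ⊔ H.piece 1 1 := by
    have h := HodgeStructure.F_eq_F_succ_sup_piece H 1
    norm_num at h
    exact h
  have hF3 : H.F 3 = ⊥ := by
    rw [hHdef, BettiUniverse.hodge_F]
    exact HodgeModel.ratF_eq_bot _ hX 2 (by norm_num)
  have hF2 : H.F 2 = H.piece 2 0 := by
    have h := HodgeStructure.F_eq_F_succ_sup_piece H 2
    norm_num at h
    rw [hF3, bot_sup_eq] at h
    exact h
  have htop : H.F 0 = ⊤ := by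
    rw [hHdef, BettiUniverse.hodge_F]
    exact HodgeModel.ratF_of_nonpos _ hX 2 le_rfl
  have hd0 : Disjoint (H.F 1) (H.piece 0 2) := by
    rw [disjoint_iff, inf_comm]
    have h := HodgeStructure.piece_inf_F_succ_sup_complexConj_eq_bot H 0
    norm_num at h
    exact le_bot_iff.mp (le_trans (inf_le_inf_left _ le_sup_left) h.le)
  have hd1 : Disjoint (H.F 2) (H.piece 1 1) := by
    rw [disjoint_iff, inf_comm]
    have h := HodgeStructure.piece_inf_F_succ_sup_complexConj_eq_bot H 1
    norm_num at h
    exact le_bot_iff.mp (le_trans (inf_le_inf_left _ le_sup_left) h.le)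
  have s0 := finrank_eigenspace_inf_sup_eq_of_disjoint gC hd0 (hstabF 1) (hstabP 0 2) μ
  have s1 := finrank_eigenspace_inf_sup_eq_of_disjoint gC hd1 (hstabF 2) (hstabP 1 1) μ
  rw [← hF0, htop, inf_top_eq] at s0
  rw [← hF1, hF2] at s1
  omega

end Betti

end Summit.HodgeConjecture.HodgeConjecture.Theorems.CyclicUnitaryPowersEigenHodgeOfGeometricGenus

end
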